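import Literature.Analysis.FluidPDE.KatoLocalL3Scaling
import Literature.Analysis.FluidPDE.KatoL3FixedPointClass
import Literature.Analysis.FluidPDE.KatoMildContinuity
import HarnessLib

/-!
# Kato's weighted local existence theorem in `L³(ℝ³)`: discharge of `kato_local_L3`

Analysis/FluidPDE proof file (no definitions, no named facts) **discharging the named fact**
`Literature.Analysis.FluidPDE.kato_local_L3` (`MildL3Smooth.lean`; Kato 1984, Thm. 1;
Lemarié-Rieusset 2016, Thm. 7.5, PDF pp. 155–158 of doi:10.1201/b19556; Giga 1986, Thm. 4,
(4.6)–(4.7)): `kato_local_L3_holds`, through its unit-viscosity form `kato_local_L3_unit`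
(`kato_local_L3_unit_holds`, `KatoLocalL3Scaling.lean`: `kato_local_L3_of_unit` by the scaling
`u(t,x) = ν w(νt, x)`), and, as an immediate consequence, the interior weighted `L^∞` bound
`mild_L3_interior_bounded` of mild `C([0,T); L³)` solutions (`mild_L3_interior_bounded_holds`,
through the tree's `mild_L3_interior_bounded_of` and the discharged restart fact
`mild_L3_restart_holds`).

The solution is assembled from the four layers of the physical-space construction:
* `KatoPicard.lean` (`exists_kato_fixedPoint`): for a strongly measurable representative `ũ₀` of
  the datum and `α = δ₀ = 1/c`, the Picard iterates of `u = e^{tΔ}ũ₀ - B(u,u)` converge at every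
  point of `(0,T₀) × ℝ³` to a measurable fixed point in Kato's class
  `‖u(t)‖₆ ≤ 2δ₀ t^{-1/4}`, `‖u(t,x)‖ ≤ L t^{-1/2}`, with the localised smallness
  `sup_{t<t₁} t^{1/4}‖u(t)‖₆ → 0` inherited from the free evolution
  (`exists_uniform_small_free_evolution`);
* `KatoMildContinuity.lean` (`continuousInLpOn_three_of_kato_fixedPoint`): `u ∈ C([0,T₀); L³)`
  and `‖u(t)‖₃ ≤ N`;
* `KatoL3FixedPointClass.lean` (`KatoL3.isMildNSSolutionOn_of_fixedPoint`): a fixed point in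
  Kato's class (which lies in Koch–Tataru's path space, `KatoL3.eKochTataruNorm_lt_top_of_kato_bounds`)
  is a mild solution in the tree's duality form `Fluid.IsMildNSSolutionOn (Ico 0 T₀) 1 0 u₀ u`
  (Lemarié-Rieusset 2016, Thm. 6.1, (6.12) ⇒ (6.11));
* the field handed back is `u` on `(0, T₀)`, the datum `u₀` itself at `t = 0`, and `0` elsewhere
  (so that the Koch–Tataru norm is finite); it agrees with the fixed point slice-wise a.e. on
  `[0, T₀)`.

## References

* T. Kato, *Strong `L^p`-solutions of the Navier–Stokes equation in `ℝ^m`, with applications to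
  weak solutions*, Math. Z. 187 (1984) 471–480, Thm. 1. [Kato1984]
* P. G. Lemarié-Rieusset, *The Navier–Stokes Problem in the 21st Century*, CRC Press 2016,
  doi:10.1201/b19556, Thm. 7.5 and its proof (PDF pp. 155–158); Thm. 6.1. [LemarieRieusset2016]
* Y. Giga, *Solutions for semilinear parabolic equations in `L^p` and regularity of weak
  solutions of the Navier–Stokes system*, J. Differential Equations 62 (1986) 186–212, Thm. 4,
  (4.6)–(4.7). [Giga1986]
-/

noncomputable section

open MeasureTheory TopologicalSpace Set Function Filter Metric
open _root_.Topology
open scoped ENNReal NNReal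

namespace Literature.Analysis.FluidPDE

/-! ### Two small tools -/

section Tools

variable {X : Type*} [MeasureSpace X] {F : Type*} [NormedAddCommGroup F]

/-- `C(S; Lᵖ)` only sees the slices up to null sets: if `w(t) = u(t)` a.e. for every `t ∈ S`,
then `w ∈ C(S; Lᵖ)` as soon as `u` is. [folklore] -/
theorem ContinuousInLpOn.congr_ae_slices {S : Set ℝ} {p : ℝ≥0∞} {u w : ℝ → X → F}
    (hu : ContinuousInLpOn S p u) (h : ∀ t ∈ S, w t =ᵐ[volume] u t) :
    ContinuousInLpOn S p w := by
  refine ⟨fun t ht => (hu.1 t ht).ae_eq (h t ht).symm, fun t₀ ht₀ => ?_⟩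
  refine (hu.2 t₀ ht₀).congr' ?_
  filter_upwards [self_mem_nhdsWithin] with t ht
  refine eLpNorm_congr_ae ?_
  filter_upwards [h t ht, h t₀ ht₀] with x h1 h2
  simp only [Pi.sub_apply, h1, h2]

/-- From the weighted smallness `t^{1/4} X ≤ b` (as an `ℝ≥0∞` inequality, `t > 0`) to
`X ≤ b t^{-1/4}`. [folklore] -/
theorem le_ofReal_mul_rpow_neg_of_weighted_le {X' : ℝ≥0∞} {t b : ℝ} (ht : 0 < t)
    (h : ENNReal.ofReal (t ^ (1 / 4 : ℝ)) * X' ≤ ENNReal.ofReal b) :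
    X' ≤ ENNReal.ofReal (b * t ^ (-(1 / 4 : ℝ))) := by
  have ht4 : 0 < t ^ (1 / 4 : ℝ) := Real.rpow_pos_of_pos ht _
  have h2 : X' ≤ ENNReal.ofReal b / ENNReal.ofReal (t ^ (1 / 4 : ℝ)) := by
    rw [ENNReal.le_div_iff_mul_le (Or.inl (ENNReal.ofReal_pos.2 ht4).ne')
      (Or.inl ENNReal.ofReal_ne_top), mul_comm]
    exact h
  refine h2.trans (le_of_eq ?_)
  rw [← ENNReal.ofReal_div_of_pos ht4, Real.rpow_neg ht.le, div_eq_mul_inv]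

end Tools

/-! ### Kato's theorem at unit viscosity -/

section Unit

/-- **Kato's weighted local existence theorem in `L³(ℝ³)` at unit viscosity, proved** (Kato
1984, Thm. 1; Lemarié-Rieusset 2016, Thm. 7.5 and its proof, PDF pp. 155–158; Giga 1986, Thm. 4).
With `c` the constant of `exists_kato_fixedPoint`, `δ₀ = 1/c` works: if
`t^{1/4}‖e^{tΔ}u₀‖₆ ≤ δ₀` on `(0, T₀)` then the Picard fixed point from a strongly measurable
representative of `u₀` exists on `(0, T₀)` in Kato's class, is continuous in `L³` on `[0, T₀)`,
and — set equal to `u₀` at `t = 0` and to `0` off `[0, T₀)` — is a mild solution in the duality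
form with `‖u(t)‖_∞ ≤ L t^{-1/2}`. [cite: Kato1984, Thm. 1] [cite: LemarieRieusset2016, Thm. 7.5 (proof, PDF pp. 155–158)] -/
theorem kato_local_L3_unit_holds : kato_local_L3_unit := by
  have hE3 : Module.finrank ℝ (EuclideanSpace ℝ (Fin 3)) = 3 := finrank_euclideanSpace_fin
  obtain ⟨c, hc, hFP⟩ := exists_kato_fixedPoint (E := EuclideanSpace ℝ (Fin 3)) hE3
  refine ⟨1 / c, by positivity, fun {T₀} hT₀ {u₀} hu₀ hdiv hsmall => ?_⟩
  have hδ : c * (1 / c) * (1 : ℝ) ^ (-(3 / 4 : ℝ)) ≤ 1 := by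
    rw [Real.one_rpow, mul_one, mul_one_div_cancel hc.ne']
  -- a strongly measurable representative of the datum
  set v₀ : EuclideanSpace ℝ (Fin 3) → EuclideanSpace ℝ (Fin 3) := hu₀.1.mk u₀ with hv₀
  have hv₀m : StronglyMeasurable v₀ := hu₀.1.stronglyMeasurable_mk
  have hae : u₀ =ᵐ[volume] v₀ := hu₀.1.ae_eq_mk
  have hv₀ : MemLp v₀ 3 volume := hu₀.ae_eq hae
  have hheat : ∀ {t : ℝ}, 0 < t → heatTest 1 v₀ t = UnboundedOperators.heatExtension u₀ t := by
    intro t ht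
    rw [heatTest_of_pos one_pos ht, one_mul, heatExtension_congr_ae hae]
  -- the smallness hypothesis in the form of the fixed-point theorem
  have hsm : ∀ t ∈ Ioo 0 T₀,
      eLpNorm (heatTest 1 v₀ t) 6 volume ≤ ENNReal.ofReal (1 / c * t ^ (-(1 / 4 : ℝ))) := by
    intro t ht
    rw [hheat ht.1]
    exact le_ofReal_mul_rpow_neg_of_weighted_le ht.1 (hsmall t ht)
  -- the fixed point
  obtain ⟨u, hum, hu0, hfix, h6, hinf, h6loc⟩ := hFP one_pos hv₀m hv₀ hT₀
    (by positivity : (0 : ℝ) < 1 / c) hδ hsm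
  set L : ℝ := 2 * (1 / c + (4 * Real.pi * 1) ^ (-(1 / 2 : ℝ)) * (eLpNorm v₀ 3 volume).toReal)
    with hL
  have hL0 : 0 ≤ L := by positivity
  -- localised smallness of the solution at `t → 0`
  have hsmall' : ∀ η : ℝ, 0 < η → ∃ t₁ : ℝ, 0 < t₁ ∧ ∀ t ∈ Ioo 0 t₁, t < T₀ →
      eLpNorm (u t) 6 volume ≤ ENNReal.ofReal (η * t ^ (-(1 / 4 : ℝ))) := by
    intro η hη
    set α₁ : ℝ := min (η / 2) (1 / c) with hα₁
    have hα₁0 : 0 < α₁ := lt_min (by positivity) (by positivity)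
    have hα₁c : c * α₁ * (1 : ℝ) ^ (-(3 / 4 : ℝ)) ≤ 1 := by
      rw [Real.one_rpow, mul_one]
      calc c * α₁ ≤ c * (1 / c) := mul_le_mul_of_nonneg_left (min_le_right _ _) hc.le
        _ = 1 := mul_one_div_cancel hc.ne'
    have hvc : ContinuousInLpOn ({0} : Set ℝ) 3 (fun _ : ℝ => v₀) :=
      ⟨fun _ _ => hv₀, fun t₀ _ => by
        simp only [sub_self, eLpNorm_zero]
        exact tendsto_const_nhds⟩
    obtain ⟨T₁, hT₁, hsmT₁⟩ := exists_uniform_small_free_evolution one_pos isCompact_singleton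
      (subset_refl _) hvc hα₁0
    refine ⟨min T₁ T₀, lt_min hT₁ hT₀, fun t ht _ => ?_⟩
    have ht₁ : t ∈ Ioo 0 T₁ := ⟨ht.1, ht.2.trans_le (min_le_left _ _)⟩
    have hloc : ∀ s ∈ Ioo 0 (min T₁ T₀),
        eLpNorm (heatTest 1 v₀ s) 6 volume ≤ ENNReal.ofReal (α₁ * s ^ (-(1 / 4 : ℝ))) := by
      intro s hs
      have h := hsmT₁ 0 (mem_singleton 0) s ⟨hs.1, hs.2.trans_le (min_le_left _ _)⟩
      rw [heatTest_of_pos one_pos hs.1]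
      exact le_ofReal_mul_rpow_neg_of_weighted_le hs.1 h
    have h := h6loc (min_le_right _ _) hα₁0 hα₁c hloc t ht
    refine h.trans (ENNReal.ofReal_le_ofReal (mul_le_mul_of_nonneg_right ?_
      (Real.rpow_nonneg ht.1.le _)))
    have : α₁ ≤ η / 2 := min_le_left _ _
    linarith
  -- `u ∈ C([0,T₀); L³)` and the `L³` bound
  obtain ⟨hcont, N, hN0, hu3⟩ := continuousInLpOn_three_of_kato_fixedPoint hE3 one_pos hv₀ hum
    (K := 2 * (1 / c)) (L := L) (by positivity) hL0 hu0 hfix h6 hinf hsmall'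
  -- the field handed back
  set w : ℝ → EuclideanSpace ℝ (Fin 3) → EuclideanSpace ℝ (Fin 3) := fun t => if t = 0 then u₀ else (Ioo 0 T₀).indicator u t with hw
  have hw0 : w 0 = u₀ := by simp only [hw, if_pos rfl]
  have hwt : ∀ t ∈ Ioo 0 T₀, w t = u t := fun t ht => by
    simp only [hw, if_neg ht.1.ne', Set.indicator_of_mem ht]
  have hwz : ∀ t, t ∉ Ioo 0 T₀ → t ≠ 0 → w t = 0 := fun t ht ht0 => by
    simp only [hw, if_neg ht0, Set.indicator_of_notMem ht]
  have hslice : ∀ t, Measurable (u t) := fun t => hum.comp (measurable_const.prodMk measurable_id)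
  -- measurability on `(0, ∞) × ℝ³`
  have hvm : Measurable (uncurry ((Ioo 0 T₀).indicator u)) :=
    measurable_uncurry_indicator_time hum measurableSet_Ioo
  have hwae : ∀ {S : Set ℝ}, MeasurableSet S → (0 : ℝ) ∉ S →
      AEStronglyMeasurable (uncurry w) ((volume : Measure (ℝ × EuclideanSpace ℝ (Fin 3))).restrict (S ×ˢ univ)) := by
    intro S hS h0
    refine hvm.aestronglyMeasurable.congr ?_
    filter_upwards [ae_restrict_mem (hS.prod MeasurableSet.univ)] with q hq
    have hq0 : q.1 ≠ 0 := fun h => h0 (h ▸ (mem_prod.1 hq).1)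
    simp only [uncurry, hw, if_neg hq0]
  have hwIoi : AEStronglyMeasurable (uncurry w)
      ((volume : Measure (ℝ × EuclideanSpace ℝ (Fin 3))).restrict (Ioi 0 ×ˢ univ)) :=
    hwae measurableSet_Ioi (fun h => lt_irrefl (0 : ℝ) h)
  have hwIoo : AEStronglyMeasurable (uncurry w)
      ((volume : Measure (ℝ × EuclideanSpace ℝ (Fin 3))).restrict (Ioo 0 T₀ ×ˢ univ)) :=
    hwae measurableSet_Ioo (fun h => lt_irrefl (0 : ℝ) h.1)
  have hwsl : ∀ t, AEStronglyMeasurable (w t) volume := by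
    intro t
    by_cases ht0 : t = 0
    · rw [ht0, hw0]; exact hu₀.1
    by_cases ht : t ∈ Ioo 0 T₀
    · rw [hwt t ht]; exact (hslice t).aestronglyMeasurable
    · rw [hwz t ht ht0]; exact aestronglyMeasurable_zero
  -- Kato's bounds for all `t > 0`
  have hwinf : ∀ t, 0 < t → eLpNorm (w t) ∞ volume ≤ ENNReal.ofReal (L * t ^ (-(1 / 2 : ℝ))) := by
    intro t ht
    by_cases htT : t < T₀
    · rw [hwt t ⟨ht, htT⟩]
      exact eLpNorm_top_le_ofReal_of_norm_le (hinf t ⟨ht, htT⟩)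
    · rw [hwz t (fun h => htT h.2) ht.ne', eLpNorm_zero]
      exact bot_le
  have hw3 : ∀ t, 0 < t → eLpNorm (w t) 3 volume ≤ ENNReal.ofReal N := by
    intro t ht
    by_cases htT : t < T₀
    · rw [hwt t ⟨ht, htT⟩]; exact hu3 t ⟨ht, htT⟩
    · rw [hwz t (fun h => htT h.2) ht.ne', eLpNorm_zero]
      exact bot_le
  have hX : eKochTataruNorm w < ∞ := KatoL3.eKochTataruNorm_lt_top_of_kato_bounds hE3 hwsl hwinf hw3
  have hw3mem : ∀ t ∈ Ioo 0 T₀, MemLp (w t) 3 volume := fun t ht => by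
    rw [hwt t ht]; exact hcont.1 t ⟨ht.1.le, ht.2⟩
  -- the fixed-point identity in the tree's form
  have hfixae : ∀ t ∈ Ioo 0 T₀, w t =ᵐ[volume]
      fun x => UnboundedOperators.heatExtension u₀ t x - kochTataruBilinear w w t x := by
    intro t ht
    refine Eventually.of_forall fun x => ?_
    rw [hwt t ht, hfix t ht x, hheat ht.1]
    congr 1
    simp only [kochTataruBilinear, one_mul]
    refine setIntegral_congr_fun measurableSet_Ioo fun s hs => ?_
    simp only [hwt s ⟨hs.1, hs.2.trans ht.2⟩]
  have hmild : IsMildNSSolutionOn (Ico 0 T₀) 1 0 u₀ w :=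
    KatoL3.isMildNSSolutionOn_of_fixedPoint hu₀ hdiv hw0 hwIoi hX hw3mem hfixae
  -- continuity in `L³` on `[0, T₀)`
  have hwcont : ContinuousInLpOn (Ico 0 T₀) 3 w := by
    refine hcont.congr_ae_slices fun t ht => ?_
    rcases ht.1.eq_or_lt with h | h
    · rw [← h, hw0, hu0]
      exact hae
    · rw [hwt t ⟨h, ht.2⟩]
  refine ⟨w, hmild, hwcont, hw0, hwIoo, L, fun t ht => ?_⟩
  refine (hwinf t ht.1).trans (le_of_eq ?_)
  rw [Real.sqrt_eq_rpow, Real.rpow_neg ht.1.le, div_eq_mul_inv L]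

/-- **Kato's weighted local existence theorem in `L³(ℝ³)`, proved**: discharge of the named fact
`kato_local_L3` (`MildL3Smooth.lean`; Kato 1984, Thm. 1; Lemarié-Rieusset 2016, Thm. 7.5) from
its unit-viscosity form by the scaling `u(t, x) = ν w(νt, x)` (`kato_local_L3_of_unit`).
[cite: Kato1984, Thm. 1] [cite: LemarieRieusset2016, Thm. 7.5 (proof, PDF pp. 155–158)] -/
theorem kato_local_L3_holds : kato_local_L3 :=
  kato_local_L3_of_unit kato_local_L3_unit_holds

/-- **Interior weighted boundedness of mild `C([0,T); L³)` solutions, proved**: discharge of the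
named fact `mild_L3_interior_bounded` (`MildL3Smooth.lean`; Giga 1986, Thm. 4, (4.6)–(4.7);
Lemarié-Rieusset 2016, Thm. 7.5) through `mild_L3_interior_bounded_of` from the discharged
restart fact (`mild_L3_restart_holds`) and Kato's theorem (`kato_local_L3_holds`).
[cite: Giga1986, Thm. 4, (4.6)–(4.7)] -/
theorem mild_L3_interior_bounded_holds : mild_L3_interior_bounded :=
  mild_L3_interior_bounded_of mild_L3_restart_holds kato_local_L3_holds

end Unit

end Literature.Analysis.FluidPDE

end
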